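import Summits.QuantumFields.YangMills.Theorems.BalabanUVNodesK0V23Defs
import Summits.QuantumFields.YangMills.Theorems.BalabanUVNodesK0V23Stub1Closer
import Literature.MathematicalPhysics.QuantumFieldTheory.Balaban1983to89.B8Prop6PrintedZdCubPGamma
import Summits.QuantumFields.YangMills.Theses.BalabanUVNodes
import Summits.QuantumFields.YangMills.Theorems.BalabanUVNodesK0AllTorusOfStepTokensGuardedZBLamPrint
import Summits.QuantumFields.YangMills.Theorems.BalabanUVNodesK0V23Stub3FinVolSuppliers
import Summits.QuantumFields.YangMills.Theorems.BalabanUVNodesK0V23Stub3Sockets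
import Summits.QuantumFields.YangMills.Theorems.BalabanUVNodesK0V23Stub3ComparabilitySuppliers

/-
  CRIT-1 g31 certification kernel `Crit1DoorCofSketch.lean` (refuter-ym-nodeO-crit-1-g31-0, 2026-08-30).
  §§1–4 = lens-1 g0's HOME `nodeO-cover/LENS-1-DoorEv.lean` sha16 97a0ca785b60b422 VERBATIM (author of record: planner-ymgap-nodeO-lens-1-g0-0);
  §5∕§6 (namespace `YMNodeOCover.Crit1.DoorCof`) = doors (α_cof) `K0BoxCofinalRadii` (HOME STATUS l.3247, text letter for letter) and (κ_cof) `K0CompCofinalRadii` (l.3249) as PROPOSED BY P3 g84;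
  P3's own kernel `SketchDoorCof.lean` d5cda46488677e6d lives in P3's session folder, not readable from this jail — re-derived here from the recipe of l.3248).
  Nothing of Bałaban asserted; every theorem is CONDITIONAL glue over accepted tree names; K0⁷ NOT closed; the Yang–Mills mass gap (Clay) is NOT proved.
-/

/-!
# LENS-1 (cauchy-analytic) — DOORS (α_ev) and (α_small): the |β| box EVENTUALLY IN `j` (§3; bookkeeping only, see the ERRATUM of §4) and AT SMALL RADII ONLY (§4; the analytic relief)
# compose to K0⁷ (kernel-checked, 0 sorry)

Cell `ym-nodeO-ideate`, LENS IDEATOR 1 (planner-ymgap-nodeO-lens-1-g0-0; count-neutral; HOME sketch, NOT a gate filing).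

v0.3 (§3): door (α_ev) `∀ F, ∃ j₀, ∀ j ≥ j₀, …box…` closes K0⁷ BY NAME — the composition consumes the box at ONE cube letter chosen by the (9)-supplier, pushable
above any `j₀` (`gauge9SupplierG3B_of_prop6MemberP` re-run at the guard `max c (L^{j₀})` through `Prop8RegSepTopStepGB.of_imp`).  CERTIFIED by CRIT-1 (STATUS l.3241).
v0.4 (§4) ERRATUM + THE REAL DOOR: β of record at the print-regime member is LETTER-BLIND in `j, ε₀, B₃, B₃′, a₁, Efl, logz`
(✓`K0V23Stub3Sockets.betaOfRecord₁₃_zbRegime_letterBlind`, `rfl`; P3 g84 STATUS l.3242), so (α_ev)'s relief is only in the SET OF RADII owed — and the cube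
letter of the (1.7) representation is an analysis letter, not the member's `θ.τ9.M = L^j`; my v0.3 reason «Thm 3 supplies (1.18) only at the member's `M = L^j ≥ M(κ)`»
conflated the two and is WITHDRAWN.  What IS load-bearing-free is the RADIUS: the ᴮ(8)-token is antitone in `a₀` (`Prop8RegSepTopStepGB.of_le`), so K0⁷ follows from
the box of `β₁₃(F; a₀, ε₂₉)` at radii `a₀ ≤ a⋆(F)` OF THE PRODUCER'S CHOOSING (door (α_small), `record13SepCoPHInhabited_of_k0BoxSmallRadii`), whereas the token-free core
of record bills EVERY radius `a₀ > 0`; [I] Thm 3 p.264 l.30–35 («ε₀, ε₁, α₀, α₁ depend on M») is served exactly by (α_small).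
Nothing of Bałaban is asserted; (α_ev), (α_small) are HYPOTHESES; K0⁷ is NOT closed; NODE O is not inhabited; the Yang–Mills mass gap (Clay) is NOT proved by any of this.
-/

noncomputable section

open MeasureTheory
open scoped Matrix.Norms.L2Operator
open Literature.MathematicalPhysics.QuantumFieldTheory.Balaban1983to89
open Literature.MathematicalPhysics.QuantumFieldTheory.Balaban1983to89.Node00
open Literature.MathematicalPhysics.QuantumFieldTheory.Balaban1983to89.T4Continuum
open Literature.MathematicalPhysics.QuantumFieldTheory.Balaban1983to89.FlowStep
open Literature.MathematicalPhysics.QuantumFieldTheory.Balaban1983to89.FlowStepRuns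
open Literature.MathematicalPhysics.QuantumFieldTheory.Balaban1983to89.B15DeterminingSets
open Literature.MathematicalPhysics.QuantumFieldTheory.Balaban1983to89.B8LeafModelZd (ZdIdx)
open Summit.QuantumFields.YangMills.Theorems.K0PrintCubeOfStepTokensGridGuardedB
open Summit.QuantumFields.YangMills.Theorems.K0AllTorusOfStepTokensGuardedZBLam
open Summit.QuantumFields.YangMills.BalabanUVNodes.N07Thm1Top7FromProp8GuardedB
open Literature.MathematicalPhysics.QuantumFieldTheory.Balaban1983to89.B8Prop6PrintedZdCubPGamma (prop6Printed_zdCubP_γ_holds_pos)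
open Summit.QuantumFields.YangMills.Theorems.K0V23Defs (AbsBetaBoxAtThm1WitnessCCMGenGridGZBAt)
open Literature.MathematicalPhysics.QuantumFieldTheory.Balaban1983to89.B12Sec2to5 (l1 betaPrime510)
open Literature.MathematicalPhysics.QuantumFieldTheory.Balaban1983to89.Node00.U3KernelLetters (PolLimitsExistBox)

namespace YMNodeOCover.Lens1.DoorEv

/-- Door (α) of record (= CRIT-1's `Crit1K0BoxTarget.K0BoxTarget`, restated here because `Cruxes/` modules are not built on the farm). [cite: Balaban1987RG1, Thm 1 p.259, §1 p.264] -/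
def K0BoxTarget : Prop := ∀ F : T4Family, AbsBetaBoxAtThm1WitnessCCMGenGridGZBAt F

/-- POST-SEAM the seam is `rfl` (= CRIT-1's `hseam_rfl`). [cite: Balaban1988Convergent, (2.12)–(2.13) pp.256–257] -/
theorem hseam_rfl :
    ∀ (F : T4Family) (θ : Stage13Params F 2) (p : B12.RunParams) (n : ℕ) (s : SeqOfRecord F θ.ν θ.τ9.M (gOfRecord₁₃ F 2 θ p) p.K (n + 1)) (W : MSField (F.P p.K) (SU 2)),
      UbgOfRecord₁₃CoP F 2 θ p (n + 1) s W = UbgMSCoPOfRecordB F 2 θ.ν θ.τ9.M (gOfRecord₁₃ F 2 θ p) p.K (n + 1) s W :=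
  fun _ _ _ _ _ _ => rfl

/-- Stub 2′'s sentence from green Literature (= CRIT-1's `prop6MemberB8AtP_of_b8Printed`). [cite: Balaban1985RegularSpaces, Prop. 6 (1.135)–(1.138) p.99] -/
theorem prop6MemberB8AtP_of_b8Printed :
    ∀ F : T4Family, ∃ (ρ₀ : ℕ) (B₁ c₁ : ℝ), 1 ≤ ρ₀ ∧ 0 ≤ B₁ ∧ 0 < c₁ ∧
      (letI : CStarAlgebra (MatA 2) := {}; B8.Prop6Printed 4 (F.L : ℝ) B₁ c₁ (fun i : ZdIdx 4 F.L => zdCubP (MatA 2) F.L ρ₀ i)) := by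
  intro F
  letI : CStarAlgebra (MatA 2) := {}
  have hL5 : 5 ≤ F.L := by have := F.hL11; omega
  obtain ⟨ρ₀, B₁, c₁, hρ₀, hB₁, hc₁, H⟩ :=
    prop6Printed_zdCubP_γ_holds_pos (𝔸 := MatA 2) (d := 4) (by norm_num) hL5 F.hL.1
  exact ⟨ρ₀, B₁, c₁, hρ₀, hB₁.le, hc₁, H (fun i : ZdIdx 4 F.L => i)⟩

/-- **Door (α_ev)** — door (α)'s box clause VERBATIM, owed only for `j ≥ j₀(F)`: the cube letter `M = L^j` eventually large, as [I] Thm 3 («M ≥ M(κ)») requires.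
[cite: Balaban1987RG1, Thm 3 p.264, (1.12) p.262, (1.18) p.263, (1.20)–(1.22) p.264; Balaban1985Variational, Thm 1 (8),(9) p.279] -/
def K0BoxTargetEv : Prop :=
  ∀ F : T4Family, ∃ j₀ : ℕ, ∀ (j c c₀ c₁ : ℕ) (B₃ B₃' a₀ a₁ : ℝ), j₀ ≤ j → c ≤ F.L ^ j → c₀ ≤ j + 1 → c₁ ≤ j → 2 * (F.L : ℝ) ^ 2 ≤ B₃ → 0 < B₃' → 0 < a₀ → 0 < a₁ →
    VariationalThm1RegSepCoP7MGB F 2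
      (fun ν M g K k _s => c ≤ ν.M₁ ∧ k + c₀ ≤ F.m + K ∧ F.L ^ c₁ ∣ M ∧
        ∀ i, 1 ≤ i → i ≤ k → dCubeSide (F.P K).L M (RkOfRecord (F.P K).L ν.r (g i)) i ∣ (F.P K).sitesPerDir 0) (lamDatum F) (dataSmall7LamTopOf F 2) B₃ a₀ a₁ →
    Gauge9RegSepTopStepGB F 2 (fun ν K Ω => suppDomOfRecord F ν K Ω) (F.L ^ j)
      (fun ν M g K k _s => c ≤ ν.M₁ ∧ k + c₀ ≤ F.m + K ∧ F.L ^ c₁ ∣ M ∧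
        ∀ i, 1 ≤ i → i ≤ k → dCubeSide (F.P K).L M (RkOfRecord (F.P K).L ν.r (g i)) i ∣ (F.P K).sitesPerDir 0) (lamDatum F) (dataSmall7LamTopOf F 2) B₃ B₃' a₀ a₁ →
    ∃ γ₀ ε₀ ε₂₉ β' : ℝ, 0 < γ₀ ∧ 0 < ε₀ ∧ 0 < ε₂₉ ∧
      BetaLowerH (-β') γ₀ (betaOfRecord₁₃ F 2 (theta13OfThm1CCMWZB F 2 j (1 / 2) a₀ ε₀ ε₂₉ B₃ B₃' a₀ a₁ (fun _ _ => 0) (fun _ _ => 0))) ∧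
      BetaUpperH β' γ₀ (betaOfRecord₁₃ F 2 (theta13OfThm1CCMWZB F 2 j (1 / 2) a₀ ε₀ ε₂₉ B₃ B₃' a₀ a₁ (fun _ _ => 0) (fun _ _ => 0)))

/-- Door (α) ⇒ door (α_ev) (take `j₀ := 0`): (α_ev) is WEAKER. [cite: Balaban1987RG1, Thm 3 p.264 (bookkeeping)] -/
theorem k0BoxTargetEv_of_k0BoxTarget (h : K0BoxTarget) : K0BoxTargetEv :=
  fun F => ⟨0, fun j c c₀ c₁ B₃ B₃' a₀ a₁ _ => h F j c c₀ c₁ B₃ B₃' a₀ a₁⟩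

/-- **The (9)-supplier above any prescribed cube exponent `j₀`** — `gauge9SupplierG3B_of_prop6MemberP` re-run at the guard letter `max c (L^{j₀})` (stub 1ᴮ's (8)-sentence is antitone in
the guard, `Prop8RegSepTopStepGB.of_imp`), so its cube letter `j` satisfies `L^{j₀} ≤ max c (L^{j₀}) ≤ c′ ≤ L^j`, i.e. `j₀ ≤ j`.
[cite: Balaban1985Variational, Prop. 8 p.304, Thm 1 (9) p.279; Balaban1985RegularSpaces, Prop. 6 p.99; Balaban1987RG1, (1.12) p.262] -/
theorem gauge9Supplier_ge (F : T4Family) (j₀ : ℕ)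
    (h2P : ∃ (ρ₀ : ℕ) (B₁ cP : ℝ), 1 ≤ ρ₀ ∧ 0 ≤ B₁ ∧ 0 < cP ∧
      (letI : CStarAlgebra (MatA 2) := {}; B8.Prop6Printed 4 (F.L : ℝ) B₁ cP (fun i : ZdIdx 4 F.L => zdCubP (MatA 2) F.L ρ₀ i)))
    (c c₀ c₁ : ℕ) (B₃ a₀ a₁ : ℝ) (hB₃ : 2 * (F.L : ℝ) ^ 2 ≤ B₃) (ha₀ : 0 < a₀) (ha₁ : 0 < a₁)
    (h8 : Prop8RegSepTopStepGB F 2 (fun ν K Ω => suppDomOfRecord F ν K Ω) (fun ν M g K k _s => c ≤ ν.M₁ ∧ k + c₀ ≤ F.m + K ∧ F.L ^ c₁ ∣ M ∧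
      ∀ i, 1 ≤ i → i ≤ k → dCubeSide (F.P K).L M (RkOfRecord (F.P K).L ν.r (g i)) i ∣ (F.P K).sitesPerDir 0) (lamDatum F) (dataSmall7LamTopOf F 2) B₃ a₀ a₁) :
    ∃ (j c' : ℕ) (B₉ a₁' : ℝ), j₀ ≤ j ∧ c ≤ c' ∧ c' ≤ F.L ^ j ∧ c₀ ≤ j + 1 ∧ c₁ ≤ j ∧ 0 < B₉ ∧ 0 < a₁' ∧ a₁' ≤ a₁ ∧
      Gauge9RegSepTopStepGB F 2 (fun ν K Ω => suppDomOfRecord F ν K Ω) (F.L ^ j) (fun ν M g K k _s => c' ≤ ν.M₁ ∧ k + c₀ ≤ F.m + K ∧ F.L ^ c₁ ∣ M ∧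
      ∀ i, 1 ≤ i → i ≤ k → dCubeSide (F.P K).L M (RkOfRecord (F.P K).L ν.r (g i)) i ∣ (F.P K).sitesPerDir 0) (lamDatum F) (dataSmall7LamTopOf F 2) B₃ B₉ a₀ a₁' := by
  have h8' : Prop8RegSepTopStepGB F 2 (fun ν K Ω => suppDomOfRecord F ν K Ω)
      (fun ν M g K k _s => max c (F.L ^ j₀) ≤ ν.M₁ ∧ k + c₀ ≤ F.m + K ∧ F.L ^ c₁ ∣ M ∧
        ∀ i, 1 ≤ i → i ≤ k → dCubeSide (F.P K).L M (RkOfRecord (F.P K).L ν.r (g i)) i ∣ (F.P K).sitesPerDir 0) (lamDatum F) (dataSmall7LamTopOf F 2) B₃ a₀ a₁ :=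
    h8.of_imp fun _ _ _ _ _ _ h => ⟨(le_max_left _ _).trans h.1, h.2⟩
  obtain ⟨j, c', B₉, a₁', hcc', hc', hc₀, hc₁, hB₉, ha₁', hle, h9⟩ :=
    gauge9SupplierG3B_of_prop6MemberP F h2P (lamDatum F) (dataSmall7LamTopOf F 2) (max c (F.L ^ j₀)) c₀ c₁ B₃ a₀ a₁ hB₃ ha₀ ha₁ h8'
  have hL1 : 1 < F.L := F.hL.2
  have hpow : F.L ^ j₀ ≤ F.L ^ j := (le_max_right _ _).trans (hcc'.trans hc')
  have hj : j₀ ≤ j := (Nat.pow_le_pow_iff_right hL1).mp hpow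
  exact ⟨j, c', B₉, a₁', hj, (le_max_left _ _).trans hcc', hc', hc₀, hc₁, hB₉, ha₁', hle, h9⟩

/-- **★ K0⁷'s DECL FROM DOOR (α_ev) ALONE, BY NAME** — PART 1's eight lines with the supplier pushed above the door's `j₀(F)`: seam `rfl` (`hseam_rfl`), stub 1ᴮ's closer
`stub_prop8StepCoPGridGB13`, stub 2′ `prop6MemberB8AtP_of_b8Printed`, `gauge9Supplier_ge`, `exists_k0H_of_thm1CoP7MGB_of_gauge9GB_of_absBoxZB_lam`.  CONDITIONAL on (α_ev); K0⁷ NOT closed.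
[cite: Balaban1985Variational, Thm 1 (8)–(9) p.279, Prop. 8 p.304; Balaban1985RegularSpaces, Prop. 6 p.99; Balaban1988Convergent, Thm 1 p.262, (2.12)–(2.13) pp.256–257; Balaban1987RG1, Thm 3 p.264, (1.12) p.262, §1 p.264] -/
theorem record13SepCoPHInhabited_of_k0BoxTargetEv (hEv : K0BoxTargetEv) :
    Summit.QuantumFields.YangMills.Theses.BalabanUVNodes.Record13SepCoPHInhabited := by
  intro F
  obtain ⟨j₀, h3⟩ := hEv F
  obtain ⟨c, c₀, c₁, B₃, a₀, a₁, hB₃, ha₀, ha₁, h8⟩ := Summit.QuantumFields.YangMills.Theorems.K0V23Stub1Closer.stub_prop8StepCoPGridGB13 F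
  have hL : (0 : ℝ) < (F.L : ℝ) := by exact_mod_cast lt_trans Nat.zero_lt_one F.hL.2
  have hBpos : (0 : ℝ) < B₃ := lt_of_lt_of_le (mul_pos two_pos (pow_pos hL 2)) hB₃
  obtain ⟨j, c', B₉, a₁', hj, hcc', hc', hc₀, hc₁, hB₉, ha₁', ha₁'le, h9⟩ :=
    gauge9Supplier_ge F j₀ (prop6MemberB8AtP_of_b8Printed F) c c₀ c₁ B₃ a₀ a₁ hB₃ ha₀ ha₁ h8
  have h15 : VariationalThm1RegSepCoP7MGB F 2 (fun ν M g K k _s => c' ≤ ν.M₁ ∧ k + c₀ ≤ F.m + K ∧ F.L ^ c₁ ∣ M ∧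
      ∀ i, 1 ≤ i → i ≤ k → dCubeSide (F.P K).L M (RkOfRecord (F.P K).L ν.r (g i)) i ∣ (F.P K).sitesPerDir 0) (lamDatum F) (dataSmall7LamTopOf F 2) B₃ a₀ a₁' :=
    (variationalThm1RegSepCoP7MGB_of_prop8TopStepGB_lamDatum hBpos (h8.of_le le_rfl ha₁'le)).of_imp fun _ _ _ _ _ _ h => ⟨hcc'.trans h.1, h.2⟩
  exact exists_k0H_of_thm1CoP7MGB_of_gauge9GB_of_absBoxZB_lam F hc' hc₀ hc₁ ha₀ hBpos.le hB₉.le ha₀ ha₁' h15 h9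
    (fun θ p n s δ W hn hpc h7 => hDat_dataSmall7LamTopOf F 2 θ p n s δ W hn hpc h7) (hseam_rfl F)
    (h3 j c' c₀ c₁ B₃ B₉ a₀ a₁' hj hc' hc₀ hc₁ hB₃ hB₉ ha₀ ha₁' h15 h9)

/-! ## §4  DOOR (α_small) — THE BOX AT SMALL RADII ONLY (the analytic relief; supersedes (α_ev) as lens-1's door)

ERRATUM to v0.3 (c) (HOME STATUS l.3238), adopting P3 g84's reading (l.3242): β of record at the print-regime member is LETTER-BLIND in `j, ε₀, B₃, B₃′, a₁, Efl, logz`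
(✓`K0V23Stub3Sockets.betaOfRecord₁₃_zbRegime_letterBlind`, `rfl`) — ONE family `β₁₃(F; a₀, ε₂₉)` — so the registered «∀ j» is free already and (α_ev)'s relief is only in the SET OF RADII
owed, which my own `gauge9Supplier_ge` shows j-cofinal from the ᴮ(8)-token: (α_ev) is a correct second proof, NOT a lever.  The cube letter `M` of N3 ∕ PiecePair is the localization cube of
the REPRESENTATION (an ∃-supplied analysis letter), not the member's `θ.τ9.M = L^j`.
THE REAL RELIEF IS IN THE RADIUS: the ᴮ(8)-token is ANTITONE in `a₀` (`Prop8RegSepTopStepGB.of_le`), the (9)-supplier and PART 1's composition run at ANY radius, and the box is read at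
the member `εbg := a₀`; so K0⁷ follows from the box of `β₁₃(F; a₀, ε₂₉)` at radii `a₀ ≤ a⋆(F)` OF THE PRODUCER'S CHOOSING, one member per radius — print's regime exactly ([I] Thm 3
p.264 l.30–35: «ε₀, ε₁, α₀, α₁ depend on M»: background ∕ small-field radii as small as the analysis at `M ≥ M(κ₀)` needs), whereas the token-free core of record
(`K0V23Stub3Sockets.k0Body_of_tokenFreeZB_byName`, `K0V23Stub3FinVolSuppliers.tokenFreeZB_of_fundamentalDomainFaceAtZB`) bills the box at EVERY radius `a₀ > 0`. -/

/-- **Door (α_small): the box of `β₁₃(F; a₀, ε₂₉)` at SMALL radii only, one print-regime member per radius** — for every family SOME `a⋆ > 0` such that for every radius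
`0 < a₀ ≤ a⋆` SOME `γ₀, ε₂₉ > 0`, `β′` and SOME member letters `(j, ε₀, B₃, B₃′, a₁, Efl, logz)` box the half-window member on `]0, γ₀]`.  WEAKER than the token-free core of record
(every radius): `k0BoxSmallRadii_of_tokenFreeCore`. [cite: Balaban1987RG1, Thm 1 p.259, Thm 3 p.264, (1.20)–(1.22) p.264, (2.9) p.266] -/
def K0BoxSmallRadii : Prop :=
  ∀ F : T4Family, ∃ aS : ℝ, 0 < aS ∧ ∀ a₀ : ℝ, 0 < a₀ → a₀ ≤ aS →
    ∃ (γ₀ ε₂₉ β' : ℝ) (j : ℕ) (ε₀ B₃ B₃' a₁ : ℝ) (Efl logz : B12.RunParams → ℕ → ℝ), 0 < γ₀ ∧ 0 < ε₂₉ ∧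
      BetaLowerH (-β') γ₀ (betaOfRecord₁₃ F 2 (theta13OfThm1CCMWZB F 2 j (1 / 2) a₀ ε₀ ε₂₉ B₃ B₃' a₀ a₁ Efl logz)) ∧
      BetaUpperH β' γ₀ (betaOfRecord₁₃ F 2 (theta13OfThm1CCMWZB F 2 j (1 / 2) a₀ ε₀ ε₂₉ B₃ B₃' a₀ a₁ Efl logz))

/-- The token-free core of record (a box at EVERY radius) gives door (α_small) (`a⋆ := 1`). [cite: Balaban1987RG1, Thm 1 p.259 (bookkeeping)] -/
theorem k0BoxSmallRadii_of_tokenFreeCore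
    (box : ∀ (F : T4Family) (a₀ : ℝ), 0 < a₀ → ∃ γ₀ ε₂₉ β' : ℝ, 0 < γ₀ ∧ 0 < ε₂₉ ∧ ∀ (j : ℕ) (ε₀ B₃ B₃' a₁ : ℝ),
      BetaLowerH (-β') γ₀ (betaOfRecord₁₃ F 2 (theta13OfThm1CCMWZB F 2 j (1 / 2) a₀ ε₀ ε₂₉ B₃ B₃' a₀ a₁ (fun _ _ => 0) (fun _ _ => 0))) ∧
      BetaUpperH β' γ₀ (betaOfRecord₁₃ F 2 (theta13OfThm1CCMWZB F 2 j (1 / 2) a₀ ε₀ ε₂₉ B₃ B₃' a₀ a₁ (fun _ _ => 0) (fun _ _ => 0)))) :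
    K0BoxSmallRadii := fun F =>
  ⟨1, one_pos, fun a₀ ha₀ _ => by
    obtain ⟨γ₀, ε₂₉, β', hγ₀, hε, h⟩ := box F a₀ ha₀
    exact ⟨γ₀, ε₂₉, β', 0, 0, 0, 0, 0, fun _ _ => 0, fun _ _ => 0, hγ₀, hε, h 0 0 0 0 0⟩⟩

/-- **★ K0⁷'s DECL FROM DOOR (α_small) ALONE, BY NAME**: stub 1ᴮ's token (✓`stub_prop8StepCoPGridGB13`) SHRUNK to the radius `min a₀ a⋆` by `Prop8RegSepTopStepGB.of_le` (antitone in
`a₀`), the (9)-supplier at that radius (`gauge9Supplier_ge`), module 53's (8)-sentence, the box at that small radius moved to the supplier's member by the census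
(`betaOfRecord₁₃_zbRegime_letterBlind`), PART 1's `exists_k0H_of_thm1CoP7MGB_of_gauge9GB_of_absBoxZB_lam` with `εbg := a₀ := min a₀ a⋆`.  CONDITIONAL on (α_small); K0⁷ NOT closed.
[cite: Balaban1985Variational, Thm 1 (8)–(9) p.279, Prop. 8 p.304; Balaban1985RegularSpaces, Prop. 6 p.99; Balaban1988Convergent, Thm 1 p.262, (2.12)–(2.13) pp.256–257; Balaban1987RG1, Thm 1 p.259, Thm 3 p.264, (1.20)–(1.22) p.264] -/
theorem record13SepCoPHInhabited_of_k0BoxSmallRadii (h : K0BoxSmallRadii) :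
    Summit.QuantumFields.YangMills.Theses.BalabanUVNodes.Record13SepCoPHInhabited := by
  intro F
  obtain ⟨aS, haS, hbox⟩ := h F
  obtain ⟨c, c₀, c₁, B₃, a₀, a₁, hB₃, ha₀, ha₁, h8⟩ := Summit.QuantumFields.YangMills.Theorems.K0V23Stub1Closer.stub_prop8StepCoPGridGB13 F
  have ha : 0 < min a₀ aS := lt_min ha₀ haS
  have h8a := h8.of_le (min_le_left a₀ aS) le_rfl
  have hL : (0 : ℝ) < (F.L : ℝ) := by exact_mod_cast lt_trans Nat.zero_lt_one F.hL.2
  have hBpos : (0 : ℝ) < B₃ := lt_of_lt_of_le (mul_pos two_pos (pow_pos hL 2)) hB₃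
  obtain ⟨j, c', B₉, a₁', -, hcc', hc', hc₀, hc₁, hB₉, ha₁', ha₁'le, h9⟩ :=
    gauge9Supplier_ge F 0 (prop6MemberB8AtP_of_b8Printed F) c c₀ c₁ B₃ (min a₀ aS) a₁ hB₃ ha ha₁ h8a
  have h15 : VariationalThm1RegSepCoP7MGB F 2 (fun ν M g K k _s => c' ≤ ν.M₁ ∧ k + c₀ ≤ F.m + K ∧ F.L ^ c₁ ∣ M ∧
      ∀ i, 1 ≤ i → i ≤ k → dCubeSide (F.P K).L M (RkOfRecord (F.P K).L ν.r (g i)) i ∣ (F.P K).sitesPerDir 0) (lamDatum F) (dataSmall7LamTopOf F 2) B₃ (min a₀ aS) a₁' :=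
    (variationalThm1RegSepCoP7MGB_of_prop8TopStepGB_lamDatum hBpos (h8a.of_le le_rfl ha₁'le)).of_imp fun _ _ _ _ _ _ h => ⟨hcc'.trans h.1, h.2⟩
  obtain ⟨γ₀, ε₂₉, β', j₁, ε₀, C₃, C₃', c₁', Efl, logz, hγ₀, hε₂₉, hlow, hup⟩ := hbox (min a₀ aS) ha (min_le_right a₀ aS)
  rw [Summit.QuantumFields.YangMills.Theorems.K0V23Stub3Sockets.betaOfRecord₁₃_zbRegime_letterBlind F j₁ j (min a₀ aS) ε₀ 1 ε₂₉ C₃ B₃ C₃' B₉ c₁' a₁' Efl logz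
    (fun _ _ => 0) (fun _ _ => 0)] at hlow hup
  exact exists_k0H_of_thm1CoP7MGB_of_gauge9GB_of_absBoxZB_lam F hc' hc₀ hc₁ ha hBpos.le hB₉.le ha ha₁' h15 h9
    (fun θ p n s δ W hn hpc h7 => hDat_dataSmall7LamTopOf F 2 θ p n s δ W hn hpc h7) (hseam_rfl F) ⟨γ₀, 1, ε₂₉, β', hγ₀, one_pos, hε₂₉, hlow, hup⟩

/-- **★ THE FUNDAMENTAL-DOMAIN FACE AT SMALL RADII ⟹ DOOR (α_small)** — the per-radius core of `K0V23Stub3FinVolSuppliers.tokenFreeZB_of_fundamentalDomainFaceAtZB` (W1's limit letter (L)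
+ the (5.10) decay (FD) at ONE window member) restricted to radii `a₀ ≤ a⋆(F)`: lens-1's N1 ∧ N2 are OWED ONLY AT SMALL BACKGROUND RADII.  CONDITIONAL; nothing inhabited.
[cite: Balaban1987RG1, Thm 1 p.259, Thm 3 p.264, (1.20)–(1.22) p.264, (5.10) p.293; Balaban1989LargeFieldII, p.355] -/
theorem k0BoxSmallRadii_of_faceAtSmallRadii
    (h : ∀ F : T4Family, ∃ aS : ℝ, 0 < aS ∧ ∀ a₀ : ℝ, 0 < a₀ → a₀ ≤ aS →
      ∃ (γ₀ ε₂₉ : ℝ) (j : ℕ) (ε₀ B₃ B₃' a₁ : ℝ) (Efl logz : B12.RunParams → ℕ → ℝ) (C δ₁ : ℝ), 0 < γ₀ ∧ γ₀ ≤ 1 / 2 ∧ 0 < ε₂₉ ∧ 0 < δ₁ ∧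
      letI θ := theta13OfThm1CCMWZB F 2 j γ₀ a₀ ε₀ ε₂₉ B₃ B₃' a₀ a₁ Efl logz
      letI := θ.instVβ₁; letI := θ.instVβ₂; letI := θ.instιβ
      PolLimitsExistBox F (mergedTermFamilyMatT F 2 (TβOfRecord₁₃ F 2) (chiβOfRecord₁₃ F 2 θ) θ.εbg) θ.ρ8 θ.bV γ₀ ∧
      ∀ k (v : Fin (k + 1) → ℝ), v ∈ Box γ₀ k → ∀ K (z : Fin 4 → ℤ), (∀ i, 2 * |z i| < ((F.P K).sitesPerDir (k + 1) : ℤ)) →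
        |polWindow F K (k + 1) (mergedTermFamilyMatT F 2 (TβOfRecord₁₃ F 2) (chiβOfRecord₁₃ F 2 θ) θ.εbg k v K) θ.ρ8 θ.bV 0 1 z| ≤ C * Real.exp (-δ₁ * l1 z)) :
    K0BoxSmallRadii := by
  intro F
  obtain ⟨aS, haS, hF⟩ := h F
  refine ⟨aS, haS, fun a₀ ha₀ hle => ?_⟩
  obtain ⟨γ₀, ε₂₉, j, ε₀, B₃, B₃', a₁, Efl, logz, C, δ₁, hγ₀, hγhalf, hε', hδ, hL, hD⟩ := hF a₀ ha₀ hle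
  have hγθ : γ₀ ≤ (theta13OfThm1CCMWZB F 2 j γ₀ a₀ ε₀ ε₂₉ B₃ B₃' a₀ a₁ Efl logz).γ := by rw [theta13OfThm1CCMWZB_γ]
  have key := Summit.QuantumFields.YangMills.Theorems.K0V23Stub3FinVolSuppliers.abs_betaOfRecord₁₃_le_of_fundamentalDomainDecayOnBox F 2 _ hγθ hδ hL hD
  have hlow : BetaLowerH (-betaPrime510 4 C δ₁) γ₀ (betaOfRecord₁₃ F 2 (theta13OfThm1CCMWZB F 2 j γ₀ a₀ ε₀ ε₂₉ B₃ B₃' a₀ a₁ Efl logz)) :=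
    fun k v hv => (abs_le.mp (key k v hv)).1
  have hup : BetaUpperH (betaPrime510 4 C δ₁) γ₀ (betaOfRecord₁₃ F 2 (theta13OfThm1CCMWZB F 2 j γ₀ a₀ ε₀ ε₂₉ B₃ B₃' a₀ a₁ Efl logz)) :=
    fun k v hv => (abs_le.mp (key k v hv)).2
  exact ⟨γ₀, ε₂₉, betaPrime510 4 C δ₁, j, ε₀, B₃, B₃', a₁, Efl, logz, hγ₀, hε',
    betaLowerH_half_of_theta13OfThm1CCMWZB hγhalf hlow, betaUpperH_half_of_theta13OfThm1CCMWZB hγhalf hup⟩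


end YMNodeOCover.Lens1.DoorEv

/-! ## §5 (CRIT-1 g31, after P3 g84 l.3247∕l.3248)  Door (α_cof): the box along radii COFINAL AT 0 of the producer's choosing ⟹ K0⁷ -/

namespace YMNodeOCover.Crit1.DoorCof

open YMNodeOCover.Lens1.DoorEv

/-- **Door (α_cof)** (P3 g84, HOME STATUS l.3247, letter for letter): for every family and every `a > 0` SOME radius `0 < a₀ ≤ a` at which SOME `γ₀, ε₂₉ > 0`, `β′` and
SOME member letters box the half-window print-regime member on `]0, γ₀]` — the box at radii ACCUMULATING AT 0 chosen by the producer, never on a whole interval.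
[cite: Balaban1987RG1, Thm 1 p.259, Thm 3 p.264, (1.20)–(1.22) p.264, (2.9) p.266 (bookkeeping)] -/
def K0BoxCofinalRadii : Prop :=
  ∀ F : T4Family, ∀ a : ℝ, 0 < a → ∃ a₀ : ℝ, 0 < a₀ ∧ a₀ ≤ a ∧
    ∃ (γ₀ ε₂₉ β' : ℝ) (j : ℕ) (ε₀ B₃ B₃' a₁ : ℝ) (Efl logz : B12.RunParams → ℕ → ℝ), 0 < γ₀ ∧ 0 < ε₂₉ ∧
      BetaLowerH (-β') γ₀ (betaOfRecord₁₃ F 2 (theta13OfThm1CCMWZB F 2 j (1 / 2) a₀ ε₀ ε₂₉ B₃ B₃' a₀ a₁ Efl logz)) ∧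
      BetaUpperH β' γ₀ (betaOfRecord₁₃ F 2 (theta13OfThm1CCMWZB F 2 j (1 / 2) a₀ ε₀ ε₂₉ B₃ B₃' a₀ a₁ Efl logz))

/-- (α_small) ⟹ (α_cof) (`a₀ := min a a⋆`). [cite: Balaban1987RG1, Thm 1 p.259 (bookkeeping)] -/
theorem k0BoxCofinalRadii_of_k0BoxSmallRadii (h : K0BoxSmallRadii) : K0BoxCofinalRadii := by
  intro F a ha
  obtain ⟨aS, haS, hbox⟩ := h F
  exact ⟨min a aS, lt_min ha haS, min_le_left a aS, hbox (min a aS) (lt_min ha haS) (min_le_right a aS)⟩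

/-- **★ K0⁷'s DECL FROM DOOR (α_cof) ALONE, BY NAME** (P3's recipe l.3248 on lens-1's §4 proof): stub 1ᴮ's token ✓`stub_prop8StepCoPGridGB13` exposes its radius `aˢ`; the door is
CALLED at `a := aˢ` and returns a radius `a₀ ≤ aˢ` with a box; the token is SHRUNK to `a₀` by `Prop8RegSepTopStepGB.of_le` (antitone); then lens-1's §4 steps verbatim with `a₀` for
`min a₀ a⋆`.  CONDITIONAL on (α_cof); K0⁷ NOT closed. [cite: Balaban1985Variational, Thm 1 (8)–(9) p.279, Prop. 8 p.304; Balaban1985RegularSpaces, Prop. 6 p.99; Balaban1988Convergent, Thm 1 p.262;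
Balaban1987RG1, Thm 1 p.259, Thm 3 p.264, (1.20)–(1.22) p.264] -/
theorem record13SepCoPHInhabited_of_k0BoxCofinalRadii (h : K0BoxCofinalRadii) :
    Summit.QuantumFields.YangMills.Theses.BalabanUVNodes.Record13SepCoPHInhabited := by
  intro F
  obtain ⟨c, c₀, c₁, B₃, aS, a₁, hB₃, haS, ha₁, h8⟩ := Summit.QuantumFields.YangMills.Theorems.K0V23Stub1Closer.stub_prop8StepCoPGridGB13 F
  obtain ⟨a₀, ha, hle, hbox⟩ := h F aS haS
  have h8a := h8.of_le hle le_rfl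
  have hL : (0 : ℝ) < (F.L : ℝ) := by exact_mod_cast lt_trans Nat.zero_lt_one F.hL.2
  have hBpos : (0 : ℝ) < B₃ := lt_of_lt_of_le (mul_pos two_pos (pow_pos hL 2)) hB₃
  obtain ⟨j, c', B₉, a₁', -, hcc', hc', hc₀, hc₁, hB₉, ha₁', ha₁'le, h9⟩ :=
    gauge9Supplier_ge F 0 (prop6MemberB8AtP_of_b8Printed F) c c₀ c₁ B₃ a₀ a₁ hB₃ ha ha₁ h8a
  have h15 : VariationalThm1RegSepCoP7MGB F 2 (fun ν M g K k _s => c' ≤ ν.M₁ ∧ k + c₀ ≤ F.m + K ∧ F.L ^ c₁ ∣ M ∧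
      ∀ i, 1 ≤ i → i ≤ k → dCubeSide (F.P K).L M (RkOfRecord (F.P K).L ν.r (g i)) i ∣ (F.P K).sitesPerDir 0) (lamDatum F) (dataSmall7LamTopOf F 2) B₃ a₀ a₁' :=
    (variationalThm1RegSepCoP7MGB_of_prop8TopStepGB_lamDatum hBpos (h8a.of_le le_rfl ha₁'le)).of_imp fun _ _ _ _ _ _ h => ⟨hcc'.trans h.1, h.2⟩
  obtain ⟨γ₀, ε₂₉, β', j₁, ε₀, C₃, C₃', c₁', Efl, logz, hγ₀, hε₂₉, hlow, hup⟩ := hbox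
  rw [Summit.QuantumFields.YangMills.Theorems.K0V23Stub3Sockets.betaOfRecord₁₃_zbRegime_letterBlind F j₁ j a₀ ε₀ 1 ε₂₉ C₃ B₃ C₃' B₉ c₁' a₁' Efl logz
    (fun _ _ => 0) (fun _ _ => 0)] at hlow hup
  exact exists_k0H_of_thm1CoP7MGB_of_gauge9GB_of_absBoxZB_lam F hc' hc₀ hc₁ ha hBpos.le hB₉.le ha ha₁' h15 h9
    (fun θ p n s δ W hn hpc h7 => hDat_dataSmall7LamTopOf F 2 θ p n s δ W hn hpc h7) (hseam_rfl F) ⟨γ₀, 1, ε₂₉, β', hγ₀, one_pos, hε₂₉, hlow, hup⟩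

/-- The radius-axis ladder end to end, by name: token-free core ⟹ (α_small) ⟹ (α_cof) ⟹ K0⁷ (type probe). -/
example (h : K0BoxSmallRadii) : Summit.QuantumFields.YangMills.Theses.BalabanUVNodes.Record13SepCoPHInhabited :=
  record13SepCoPHInhabited_of_k0BoxCofinalRadii (k0BoxCofinalRadii_of_k0BoxSmallRadii h)

/-! ## §6 (CRIT-1 g31, after P3 g84 l.3249)  Door (κ_cof): COMPARABILITY shape × one print-regime member × COFINAL radii ⟹ K0⁷ -/

/-- **Door (κ_cof)** (P3 g84, HOME STATUS l.3249): along radii accumulating at 0, at ONE member, SOME `γ₀, ε₂₉ > 0` with the TWO-SIDED COMPARABILITY of consecutive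
couplings along every solution of the RG equation of `β₁₃(F; a₀, ε₂₉)` inside `]0, γ₀]` — the shape-weakest × radius-weakest typed corner. [cite: Balaban1987RG1, Thm 1 p.259, Thm 3 p.264, §1 p.264 (bookkeeping)] -/
def K0CompCofinalRadii : Prop :=
  ∀ F : T4Family, ∀ a : ℝ, 0 < a → ∃ a₀ : ℝ, 0 < a₀ ∧ a₀ ≤ a ∧
    ∃ (γ₀ ε₂₉ : ℝ) (j : ℕ) (ε₀ B₃ B₃' a₁ : ℝ) (Efl logz : B12.RunParams → ℕ → ℝ), 0 < γ₀ ∧ 0 < ε₂₉ ∧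
      ∀ (n : ℕ) (gs : ℕ → ℝ), RGEqH n (betaOfRecord₁₃ F 2 (theta13OfThm1CCMWZB F 2 j (1 / 2) a₀ ε₀ ε₂₉ B₃ B₃' a₀ a₁ Efl logz)) gs →
        Step.InInterval γ₀ n gs → ∀ m, m < n → gs m ≤ 2 * gs (m + 1) ∧ gs (m + 1) ≤ 2 * gs m

/-- **★ K0⁷'s DECL FROM DOOR (κ_cof) ALONE, BY NAME** (P3 g84's §6, l.3249, re-derived): the §5 proof with PART 1 swapped for its comparability twin
✓`K0V23Stub3ComparabilitySuppliers.exists_k0H_of_thm1CoP7MGB_of_gauge9GB_of_twoComparableZB_lam` and the census `rw` on the `RGEqH` clause.  CONDITIONAL on (κ_cof); K0⁷ NOT closed.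
[cite: Balaban1985Variational, Thm 1 (8)–(9) p.279, Prop. 8 p.304; Balaban1988Convergent, Thm 1 p.262; Balaban1987RG1, Thm 1 p.259, Thm 3 p.264, §1 p.264, (1.20)–(1.22) p.264] -/
theorem record13SepCoPHInhabited_of_k0CompCofinalRadii (h : K0CompCofinalRadii) :
    Summit.QuantumFields.YangMills.Theses.BalabanUVNodes.Record13SepCoPHInhabited := by
  intro F
  obtain ⟨c, c₀, c₁, B₃, aS, a₁, hB₃, haS, ha₁, h8⟩ := Summit.QuantumFields.YangMills.Theorems.K0V23Stub1Closer.stub_prop8StepCoPGridGB13 F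
  obtain ⟨a₀, ha, hle, hC⟩ := h F aS haS
  have h8a := h8.of_le hle le_rfl
  have hL : (0 : ℝ) < (F.L : ℝ) := by exact_mod_cast lt_trans Nat.zero_lt_one F.hL.2
  have hBpos : (0 : ℝ) < B₃ := lt_of_lt_of_le (mul_pos two_pos (pow_pos hL 2)) hB₃
  obtain ⟨j, c', B₉, a₁', -, hcc', hc', hc₀, hc₁, hB₉, ha₁', ha₁'le, h9⟩ :=
    gauge9Supplier_ge F 0 (prop6MemberB8AtP_of_b8Printed F) c c₀ c₁ B₃ a₀ a₁ hB₃ ha ha₁ h8a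
  have h15 : VariationalThm1RegSepCoP7MGB F 2 (fun ν M g K k _s => c' ≤ ν.M₁ ∧ k + c₀ ≤ F.m + K ∧ F.L ^ c₁ ∣ M ∧
      ∀ i, 1 ≤ i → i ≤ k → dCubeSide (F.P K).L M (RkOfRecord (F.P K).L ν.r (g i)) i ∣ (F.P K).sitesPerDir 0) (lamDatum F) (dataSmall7LamTopOf F 2) B₃ a₀ a₁' :=
    (variationalThm1RegSepCoP7MGB_of_prop8TopStepGB_lamDatum hBpos (h8a.of_le le_rfl ha₁'le)).of_imp fun _ _ _ _ _ _ h => ⟨hcc'.trans h.1, h.2⟩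
  obtain ⟨γ₀, ε₂₉, j₁, ε₀, C₃, C₃', c₁', Efl, logz, hγ₀, hε₂₉, hC⟩ := hC
  rw [Summit.QuantumFields.YangMills.Theorems.K0V23Stub3Sockets.betaOfRecord₁₃_zbRegime_letterBlind F j₁ j a₀ ε₀ 1 ε₂₉ C₃ B₃ C₃' B₉ c₁' a₁' Efl logz
    (fun _ _ => 0) (fun _ _ => 0)] at hC
  exact Summit.QuantumFields.YangMills.Theorems.K0V23Stub3ComparabilitySuppliers.exists_k0H_of_thm1CoP7MGB_of_gauge9GB_of_twoComparableZB_lam F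
    hc' hc₀ hc₁ ha hBpos.le hB₉.le ha ha₁' h15 h9
    (fun θ p n s δ W hn hpc h7 => hDat_dataSmall7LamTopOf F 2 θ p n s δ W hn hpc h7) (hseam_rfl F) ⟨γ₀, 1, ε₂₉, hγ₀, one_pos, hε₂₉, hC⟩

end YMNodeOCover.Crit1.DoorCof


end
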